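import Literature.NumberTheory.LFunctions.Zhang2022.KnifeEdgeEllVernier
import Literature.NumberTheory.LFunctions.Zhang2022.ObjectiveTwinDetAfeK13

/-!
# Zhang (2022), knife edge `ell` — the booked vernier recipe: a W-fixed DILATION of an admissible far-pair
# recipe is NOT positive semidefinite (kernel record of the cell's probe (C))

Y. Zhang, *Discrete mean estimates and the Landau–Siegel zero*, arXiv:2211.02515v1 (2022)
[Zhang2022LandauSiegel] — an unrefereed manuscript under adjudication. **This file SEARCHES and TYPES; it makes
no claim about Landau–Siegel zeros, about Theorems 1–2 of the manuscript, or about a repaired (2.32), until a kernel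
theorem says so.** LANDAU–SIEGEL programme, cell `landau-siegel`, §D edge `ell`, card «ell-vernier-far-pair»
(CLOSED falsified 2026-08-27T01:55Z): the typed family `KnifeEdgeEll.Vernier.VernierBookedPSD b₀ J m δ φ`
(`KnifeEdgeEllVernier`, «OPEN — asserted by no one; a certified/kernel decision either way») is decided here BY THE
KERNEL on one explicit sub-family — the cell's probe (C) «pure dilation `δ`, weights fixed» (ls-knife-crit-2
probe-vernier.md v2; certified negative on finite spaces by the lineage-A/B eigen-scans): for the ADMISSIBLE far pair
`vernierShifts 1 3 0 = (1, 3, 4)` (`Det.SignAdmissible`, `k = 3`) and every dilation `δ > 0`,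

  `FormDet (vernierBooked 1 3 0 δ 0) (k₁ − k₃) = −(32π/3)·δ·(8δ² + 5δ + 2) < 0`,

so `¬ VernierBookedPSD 1 3 0 δ 0` for all `δ > 0` (`not_vernierBookedPSD_far34_dilate`), while at `δ = 0` the
direction `k₁ − k₃` is NULL for the `θ`-blind recipe (`formDet_vernierBooked_far34_k13` at `δ = 0` gives `0`). This is
the far-pair analogue of `MainTermFormEll.mainTermFormEll_neg_of_one_lt` (`F_ℓ` indefinite for every `ℓ > 1`,
witness on the `K`-plane): the `ellRecipe`-type deformation `b ↦ (1+δ)b` of the integrand with the residue weights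
`W = shiftW b` held fixed turns a null AFE direction into a negative one at first order in `δ`. Route:
`Det.formDet_recipe_k13` (formula I of ANY recipe on `k₁ − k₃` in the six channel moments) + the exact weights
`shiftW (1,3,4) = (−1/6, 3/2, 4/3)` (phases `e^{3πi} = e^{iπ} = −1`, `e⁰ = 1`). WHAT THIS IS NOT: not a statement
about the CONSISTENT booking (near shift and far pair converted with the same factor — certified PSD by the cell's
numerics and the reason the card closed), and not an endorsement of `Det.shiftW` for `b ≠ (1,2,3)` (registry E-010).
Theorems only; no new definitions.
-/

noncomputable section

open Complex Real

namespace Literature.NumberTheory.LFunctions.Zhang2022.KnifeEdgeEll.Vernier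

open Det

/-- `vernierShifts 1 3 0 = (1, 3, 4)` — the far pair a full gap wide at `J = 3`, near shift `1`.
[cite: Zhang2022LandauSiegel, §2 (2.13)] -/
theorem vernierShifts_one_three_zero : vernierShifts 1 3 0 = ![1, 3, 4] := by
  funext j; fin_cases j <;> (simp [vernierShifts]; try norm_num)

/-- `s(1, 3, 4) = (7, 5, 4)`. [cite: Zhang2022LandauSiegel, §8 (8.13)–(8.18)] -/
theorem shiftS_far34 : shiftS ![1, 3, 4] = ![7, 5, 4] := by
  funext j; fin_cases j <;> (simp [shiftS]; try norm_num)

/-- `n(1, 3, 4) = (12, 4, 3)`. [cite: Zhang2022LandauSiegel, §8 (8.13)–(8.18)] -/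
theorem shiftN_far34 : shiftN ![1, 3, 4] = ![12, 4, 3] := by
  funext j; fin_cases j <;> (simp [shiftN]; try norm_num)

/-- **`W(1, 3, 4) = (−1/6, 3/2, 4/3)`** (phases `e^{3πi} = −1`, `e^{iπ} = −1`, `e⁰ = 1` against `v = (6, −2, 3)`).
[cite: Zhang2022LandauSiegel, proof of Prop 7.1, (7.19)–(7.21)] -/
theorem shiftW_far34 : shiftW ![1, 3, 4] = ![-(1 / 6 : ℂ), 3 / 2, 4 / 3] := by
  funext j
  fin_cases j
  · simp only [shiftW, shiftS, shiftVdm]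
    simp only [Fin.zero_eta, Fin.isValue, Matrix.cons_val_zero, Matrix.cons_val_one, Matrix.head_cons,
      Matrix.cons_val_two, Matrix.tail_cons]
    have h : cexp (I * π * (((3 + 4 - 1) / 2 : ℝ) : ℂ)) = -1 := by
      rw [show (((3 + 4 - 1) / 2 : ℝ) : ℂ) = 3 by push_cast; norm_num,
        show I * π * 3 = (π : ℂ) * I + (2 * π) * I by ring, Complex.exp_add, Complex.exp_two_pi_mul_I,
        Complex.exp_pi_mul_I]
      simp
    rw [h]; push_cast; norm_num
  · simp only [shiftW, shiftS, shiftVdm]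
    simp only [Fin.mk_one, Fin.isValue, Matrix.cons_val_zero, Matrix.cons_val_one, Matrix.head_cons,
      Matrix.cons_val_two, Matrix.tail_cons]
    have h : cexp (I * π * (((4 + 1 - 3) / 2 : ℝ) : ℂ)) = -1 := by
      rw [show (((4 + 1 - 3) / 2 : ℝ) : ℂ) = 1 by push_cast; norm_num,
        show I * π * 1 = π * I by ring, Complex.exp_pi_mul_I]
    rw [h]; push_cast; norm_num
  · simp only [shiftW, shiftS, shiftVdm]
    simp only [Fin.reduceFinMk, Fin.isValue, Matrix.cons_val_zero, Matrix.cons_val_one, Matrix.head_cons,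
      Matrix.cons_val_two, Matrix.tail_cons]
    have h : cexp (I * π * (((1 + 3 - 4) / 2 : ℝ) : ℂ)) = 1 := by
      rw [show (((1 + 3 - 4) / 2 : ℝ) : ℂ) = 0 by push_cast; norm_num, mul_zero, Complex.exp_zero]
    rw [h]; push_cast; norm_num

/-- The booked vernier recipe at `(b₀, J, m) = (1, 3, 0)`, no phases: weights `W(1,3,4)` FIXED, integrand
coefficients dilated — `b = (1+δ)(1,3,4)`, `s = (1+δ)(7,5,4)`, `n = (1+δ)²(12,4,3)`.
[cite: Zhang2022LandauSiegel, Prop 7.1, (7.19)–(7.21); §2 (2.13)] -/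
theorem vernierBooked_far34 (δ : ℝ) :
    vernierBooked 1 3 0 δ (fun _ => 0) =
      ⟨![-(1 / 6 : ℂ), 3 / 2, 4 / 3], fun j => (1 + δ) * (![1, 3, 4] : Fin 3 → ℝ) j,
        fun j => (1 + δ) * (![7, 5, 4] : Fin 3 → ℝ) j, fun j => (1 + δ) ^ 2 * (![12, 4, 3] : Fin 3 → ℝ) j⟩ := by
  rw [vernierBooked, vernierShifts_one_three_zero]
  ext j
  · simp only [bookedRecipe, shiftW_far34, Complex.ofReal_zero, mul_zero, Complex.exp_zero, mul_one]
  · simp only [bookedRecipe]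
  · simp only [bookedRecipe, shiftS_far34]
  · simp only [bookedRecipe, shiftN_far34]

/-- The six channel moments of the dilated far-pair recipe:
`(m₀, m_s, m_n, m_b, m_bs, m_bn) = (8/3, (35/3)(1+δ), 8(1+δ)², (29/3)(1+δ), (128/3)(1+δ)², 32(1+δ)³)` — all real.
[cite: Zhang2022LandauSiegel, Prop 7.1 p.44, (8.11)–(8.23)] -/
theorem moments_vernierBooked_far34 (δ : ℝ) :
    (∑ j : Fin 3, (vernierBooked 1 3 0 δ (fun _ => 0)).W j) = 8 / 3 ∧
    (∑ j : Fin 3, (vernierBooked 1 3 0 δ (fun _ => 0)).W j * ((vernierBooked 1 3 0 δ (fun _ => 0)).s j : ℂ))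
      = 35 / 3 * (1 + (δ : ℂ)) ∧
    (∑ j : Fin 3, (vernierBooked 1 3 0 δ (fun _ => 0)).W j * ((vernierBooked 1 3 0 δ (fun _ => 0)).n j : ℂ))
      = 8 * (1 + (δ : ℂ)) ^ 2 ∧
    (∑ j : Fin 3, (vernierBooked 1 3 0 δ (fun _ => 0)).W j * ((vernierBooked 1 3 0 δ (fun _ => 0)).b j : ℂ))
      = 29 / 3 * (1 + (δ : ℂ)) ∧
    (∑ j : Fin 3, (vernierBooked 1 3 0 δ (fun _ => 0)).W j *
        (((vernierBooked 1 3 0 δ (fun _ => 0)).b j : ℂ) * ((vernierBooked 1 3 0 δ (fun _ => 0)).s j : ℂ)))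
      = 128 / 3 * (1 + (δ : ℂ)) ^ 2 ∧
    (∑ j : Fin 3, (vernierBooked 1 3 0 δ (fun _ => 0)).W j *
        (((vernierBooked 1 3 0 δ (fun _ => 0)).b j : ℂ) * ((vernierBooked 1 3 0 δ (fun _ => 0)).n j : ℂ)))
      = 32 * (1 + (δ : ℂ)) ^ 3 := by
  rw [vernierBooked_far34]
  simp only [Fin.sum_univ_three, Fin.isValue, Matrix.cons_val_zero, Matrix.cons_val_one, Matrix.head_cons,
    Matrix.cons_val_two, Matrix.tail_cons]
  push_cast
  refine ⟨by ring, by ring, by ring, by ring, by ring, by ring⟩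

/-- **THE DILATION WITNESS, EXACT**: on the one-sided AFE direction `k₁ − k₃` (`‖·‖² = 2`, vanishing at `1`),
`FormDet (vernierBooked 1 3 0 δ 0) (k₁ − k₃) = −(32π/3)·δ·(8δ² + 5δ + 2)` for EVERY real `δ`
(`= (32π/3)(5 − 16c + 19c² − 8c³)`, `c = 1+δ`; zero at `δ = 0`: `k₁ − k₃` is a null direction of the `θ`-blind
far-pair recipe `shiftRecipe (1,3,4)`). [cite: Zhang2022LandauSiegel, Prop 7.1 p.44 with (8.11)–(8.23); §2 (2.13)] -/
theorem formDet_vernierBooked_far34_k13 (δ : ℝ) :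
    FormDet (vernierBooked 1 3 0 δ (fun _ => 0))
        (fun y => (1:ℂ) * afeDir 1 y + 0 * afeDir 2 y + (-1) * afeDir 3 y)
        (fun y => (1:ℂ) * afeDir' 1 y + 0 * afeDir' 2 y + (-1) * afeDir' 3 y)
      = -(32 * π / 3) * δ * (8 * δ ^ 2 + 5 * δ + 2) := by
  obtain ⟨h0, hs, hn, hb, hbs, hbn⟩ := moments_vernierBooked_far34 δ
  rw [formDet_recipe_k13, h0, hs, hn, hb, hbs, hbn]
  have e1 : (35 / 3 * (1 + (δ : ℂ))).re = 35 / 3 * (1 + δ) := by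
    rw [show (35 / 3 * (1 + (δ : ℂ))) = ((35 / 3 * (1 + δ) : ℝ) : ℂ) by push_cast; ring, Complex.ofReal_re]
  have e2 : (8 * (1 + (δ : ℂ)) ^ 2).re = 8 * (1 + δ) ^ 2 := by
    rw [show (8 * (1 + (δ : ℂ)) ^ 2) = ((8 * (1 + δ) ^ 2 : ℝ) : ℂ) by push_cast; ring, Complex.ofReal_re]
  have e3 : (29 / 3 * (1 + (δ : ℂ))).re = 29 / 3 * (1 + δ) := by
    rw [show (29 / 3 * (1 + (δ : ℂ))) = ((29 / 3 * (1 + δ) : ℝ) : ℂ) by push_cast; ring, Complex.ofReal_re]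
  have e4 : (128 / 3 * (1 + (δ : ℂ)) ^ 2).re = 128 / 3 * (1 + δ) ^ 2 := by
    rw [show (128 / 3 * (1 + (δ : ℂ)) ^ 2) = ((128 / 3 * (1 + δ) ^ 2 : ℝ) : ℂ) by push_cast; ring, Complex.ofReal_re]
  have e5 : (32 * (1 + (δ : ℂ)) ^ 3).re = 32 * (1 + δ) ^ 3 := by
    rw [show (32 * (1 + (δ : ℂ)) ^ 3) = ((32 * (1 + δ) ^ 3 : ℝ) : ℂ) by push_cast; ring, Complex.ofReal_re]
  have e6 : (32 * (1 + (δ : ℂ)) ^ 3).im = 0 := by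
    rw [show (32 * (1 + (δ : ℂ)) ^ 3) = ((32 * (1 + δ) ^ 3 : ℝ) : ℂ) by push_cast; ring, Complex.ofReal_im]
  have e0 : ((8 : ℂ) / 3).re = 8 / 3 := by norm_num
  rw [e0, e1, e2, e3, e4, e5, e6]
  ring

/-- **Every W-fixed dilation of the admissible far-pair recipe `(1; 3, 4)` is NOT PSD**: for all `δ > 0`,
`¬ VernierBookedPSD 1 3 0 δ 0` — witness `k₁ − k₃`, value `−(32π/3)δ(8δ² + 5δ + 2) < 0`. (The far-pair analogue of
`F_ℓ` losing positivity for every `ℓ > 1`; the cell's probe (C), kernel-grade; the CONSISTENT booking, where the near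
shift is converted with the same factor, is the PSD case and is not this statement.)
[cite: Zhang2022LandauSiegel, Prop 7.1 p.44, (7.2); §2 (2.13)] -/
theorem not_vernierBookedPSD_far34_dilate {δ : ℝ} (hδ : 0 < δ) : ¬ VernierBookedPSD 1 3 0 δ (fun _ => 0) := by
  intro h
  have hu1 : (fun y : ℝ => (1:ℂ) * afeDir 1 y + 0 * afeDir 2 y + (-1) * afeDir 3 y) 1 = 0 := by
    simp only [afeDir_one]; norm_num
  have hv := h _ _ (kinkedProfile_afeSpan 1 0 (-1)) hu1
  rw [formDet_vernierBooked_far34_k13] at hv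
  have hq : 0 < 8 * δ ^ 2 + 5 * δ + 2 := by positivity
  have hπ : 0 < π := Real.pi_pos
  have : 0 < 32 * π / 3 * δ * (8 * δ ^ 2 + 5 * δ + 2) := by positivity
  linarith

/-- The same in witness form: `Det.FormDetNegWitness (vernierBooked 1 3 0 δ 0)` for every `δ > 0`
(`not_vernierBookedPSD_iff`). [cite: Zhang2022LandauSiegel, Prop 7.1 p.44, (7.2)] -/
theorem formDetNegWitness_vernierBooked_far34_dilate {δ : ℝ} (hδ : 0 < δ) :
    FormDetNegWitness (vernierBooked 1 3 0 δ (fun _ => 0)) :=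
  (not_vernierBookedPSD_iff 1 3 0 δ (fun _ => 0)).mp (not_vernierBookedPSD_far34_dilate hδ)

/-- A contraction (`δ < 0`, `δ > −1` irrelevant) makes the same direction strictly POSITIVE:
`FormDet (vernierBooked 1 3 0 δ 0) (k₁ − k₃) > 0` for `δ < 0` — so the sign of the booked form on this
direction is decided by the sign of the dilation alone. [cite: Zhang2022LandauSiegel, Prop 7.1 p.44; §2 (2.13)] -/
theorem formDet_vernierBooked_far34_k13_pos_of_neg {δ : ℝ} (hδ : δ < 0) :
    0 < FormDet (vernierBooked 1 3 0 δ (fun _ => 0))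
        (fun y => (1:ℂ) * afeDir 1 y + 0 * afeDir 2 y + (-1) * afeDir 3 y)
        (fun y => (1:ℂ) * afeDir' 1 y + 0 * afeDir' 2 y + (-1) * afeDir' 3 y) := by
  rw [formDet_vernierBooked_far34_k13]
  have hq : 0 < 8 * δ ^ 2 + 5 * δ + 2 := by nlinarith [sq_nonneg (δ + 5 / 16)]
  have hπ : 0 < π := Real.pi_pos
  have h1 : 0 < -δ := by linarith
  have : 0 < 32 * π / 3 * (-δ) * (8 * δ ^ 2 + 5 * δ + 2) := by positivity
  linarith

/-! ## Part 2 (appended) — probe (B): ONE near-channel phase on the PRINTED recipe (`vernierShifts 1 2 0 = (1,2,3)`)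

The cell's probe (B) («one-phase caricature», ls-knife-crit-2 probe-vernier.md v2) and the custody-A boundary law
(ls-num-1, kit j264242: PSD iff `|φ₀| ≤ 2m`) at `m = 0` predict that ANY near-channel phase `φ₀ ∈ (0,1)` (or
`(−1,0)`) destroys positivity. Kernel form on the printed triple: with `W = (e^{iπφ₀}/2, 2, 3/2)` and the printed
integrand coefficients, formula I on `k₁ − k₃` is EXACTLY `−(16/3)·sin(πφ₀)` — all `π`-terms cancel (they are the
printed recipe's null value on `k₁ − k₃`), only the `Im m_bn` term survives. -/

/-- `vernierShifts 1 2 0 = (1, 2, 3)` — the printed triple. [cite: Zhang2022LandauSiegel, §2 (2.13); §8 (8.19)–(8.22)] -/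
theorem vernierShifts_one_two_zero : vernierShifts 1 2 0 = ![1, 2, 3] := by
  funext j; fin_cases j <;> (simp [vernierShifts]; try norm_num)

/-- `e^{iπφ₀} = cos(πφ₀) + i·sin(πφ₀)` with real-valued parts. [folklore] -/
private theorem cexp_I_pi_mul (φ₀ : ℝ) :
    cexp (I * π * (φ₀ : ℂ)) = (Real.cos (π * φ₀) : ℂ) + (Real.sin (π * φ₀) : ℂ) * I := by
  rw [show I * π * (φ₀ : ℂ) = ((π * φ₀ : ℝ) : ℂ) * I by push_cast; ring, Complex.exp_mul_I,
    ← Complex.ofReal_cos, ← Complex.ofReal_sin]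

/-- The booked printed recipe with one near-channel phase `φ₀` (no dilation): weights
`(e^{iπφ₀}/2, 2, 3/2)`, printed coefficients `b = (1,2,3)`, `s = (5,4,3)`, `n = (6,3,2)`.
[cite: Zhang2022LandauSiegel, Prop 7.1, (7.19)–(7.21); §8 (8.19)–(8.22)] -/
theorem vernierBooked_std_nearPhase (φ₀ : ℝ) :
    vernierBooked 1 2 0 0 ![φ₀, 0, 0] =
      ⟨![(1 / 2 : ℂ) * ((Real.cos (π * φ₀) : ℂ) + (Real.sin (π * φ₀) : ℂ) * I), 2, 3 / 2],
        fun j => (1 + 0) * (![1, 2, 3] : Fin 3 → ℝ) j,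
        fun j => (1 + 0) * (![5, 4, 3] : Fin 3 → ℝ) j, fun j => (1 + 0) ^ 2 * (![6, 3, 2] : Fin 3 → ℝ) j⟩ := by
  rw [vernierBooked, vernierShifts_one_two_zero]
  ext j
  · fin_cases j
    · simp only [bookedRecipe, shiftW_std, Fin.zero_eta, Fin.isValue, Matrix.cons_val_zero, cexp_I_pi_mul]
    · simp only [bookedRecipe, shiftW_std, Fin.mk_one, Fin.isValue, Matrix.cons_val_one,
        Matrix.cons_val_zero, Complex.ofReal_zero, mul_zero, Complex.exp_zero, mul_one]
    · simp only [bookedRecipe, shiftW_std, Fin.reduceFinMk, Fin.isValue, Matrix.cons_val_two, Matrix.tail_cons,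
        Matrix.head_cons, Complex.ofReal_zero, mul_zero, Complex.exp_zero, mul_one]
  · simp only [bookedRecipe]
  · simp only [bookedRecipe, shiftS_std]
  · simp only [bookedRecipe, shiftN_std]

/-- The six channel moments of the phased printed recipe, split into real and imaginary parts
(`c = cos(πφ₀)`, `s = sin(πφ₀)`): `m₀ = 7/2 + c/2 + (s/2)i`, `m_s = 25/2 + 5c/2 + (5s/2)i`, `m_n = 9 + 3c + 3si`,
`m_b = 17/2 + c/2 + (s/2)i`, `m_bs = 59/2 + 5c/2 + (5s/2)i`, `m_bn = 21 + 3c + 3si`.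
[cite: Zhang2022LandauSiegel, Prop 7.1 p.44, (8.11)–(8.23)] -/
theorem moments_vernierBooked_std_nearPhase (φ₀ : ℝ) :
    (∑ j : Fin 3, (vernierBooked 1 2 0 0 ![φ₀, 0, 0]).W j)
      = ((7 / 2 + Real.cos (π * φ₀) / 2 : ℝ) : ℂ) + ((Real.sin (π * φ₀) / 2 : ℝ) : ℂ) * I ∧
    (∑ j : Fin 3, (vernierBooked 1 2 0 0 ![φ₀, 0, 0]).W j * ((vernierBooked 1 2 0 0 ![φ₀, 0, 0]).s j : ℂ))
      = ((25 / 2 + 5 * Real.cos (π * φ₀) / 2 : ℝ) : ℂ) + ((5 * Real.sin (π * φ₀) / 2 : ℝ) : ℂ) * I ∧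
    (∑ j : Fin 3, (vernierBooked 1 2 0 0 ![φ₀, 0, 0]).W j * ((vernierBooked 1 2 0 0 ![φ₀, 0, 0]).n j : ℂ))
      = ((9 + 3 * Real.cos (π * φ₀) : ℝ) : ℂ) + ((3 * Real.sin (π * φ₀) : ℝ) : ℂ) * I ∧
    (∑ j : Fin 3, (vernierBooked 1 2 0 0 ![φ₀, 0, 0]).W j * ((vernierBooked 1 2 0 0 ![φ₀, 0, 0]).b j : ℂ))
      = ((17 / 2 + Real.cos (π * φ₀) / 2 : ℝ) : ℂ) + ((Real.sin (π * φ₀) / 2 : ℝ) : ℂ) * I ∧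
    (∑ j : Fin 3, (vernierBooked 1 2 0 0 ![φ₀, 0, 0]).W j *
        (((vernierBooked 1 2 0 0 ![φ₀, 0, 0]).b j : ℂ) * ((vernierBooked 1 2 0 0 ![φ₀, 0, 0]).s j : ℂ)))
      = ((59 / 2 + 5 * Real.cos (π * φ₀) / 2 : ℝ) : ℂ) + ((5 * Real.sin (π * φ₀) / 2 : ℝ) : ℂ) * I ∧
    (∑ j : Fin 3, (vernierBooked 1 2 0 0 ![φ₀, 0, 0]).W j *
        (((vernierBooked 1 2 0 0 ![φ₀, 0, 0]).b j : ℂ) * ((vernierBooked 1 2 0 0 ![φ₀, 0, 0]).n j : ℂ)))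
      = ((21 + 3 * Real.cos (π * φ₀) : ℝ) : ℂ) + ((3 * Real.sin (π * φ₀) : ℝ) : ℂ) * I := by
  rw [vernierBooked_std_nearPhase]
  simp only [Fin.sum_univ_three, Fin.isValue, Matrix.cons_val_zero, Matrix.cons_val_one, Matrix.head_cons,
    Matrix.cons_val_two, Matrix.tail_cons]
  push_cast
  refine ⟨by ring, by ring, by ring, by ring, by ring, by ring⟩

/-- **THE PHASE WITNESS, EXACT**: `FormDet (vernierBooked 1 2 0 0 (φ₀,0,0)) (k₁ − k₃) = −(16/3)·sin(πφ₀)` for EVERY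
real `φ₀` — the printed recipe's null value on `k₁ − k₃` (`formDet_zhang_k13`) tilts with the sign of the
near-channel phase (all `π`-terms cancel; only `Im m_bn` survives). [cite: Zhang2022LandauSiegel, Prop 7.1 p.44 with (8.11)–(8.23); §2 (2.13)] -/
theorem formDet_vernierBooked_std_nearPhase_k13 (φ₀ : ℝ) :
    FormDet (vernierBooked 1 2 0 0 ![φ₀, 0, 0])
        (fun y => (1:ℂ) * afeDir 1 y + 0 * afeDir 2 y + (-1) * afeDir 3 y)
        (fun y => (1:ℂ) * afeDir' 1 y + 0 * afeDir' 2 y + (-1) * afeDir' 3 y)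
      = -(16 / 3) * Real.sin (π * φ₀) := by
  obtain ⟨h0, hs, hn, hb, hbs, hbn⟩ := moments_vernierBooked_std_nearPhase φ₀
  rw [formDet_recipe_k13, h0, hs, hn, hb, hbs, hbn]
  simp only [Complex.add_re, Complex.add_im, Complex.mul_re, Complex.mul_im, Complex.I_re, Complex.I_im,
    Complex.ofReal_re, Complex.ofReal_im, mul_zero, mul_one, add_zero, sub_zero, zero_add]
  ring

/-- **Any near-channel phase `φ₀ ∈ (0,1)` on the PRINTED recipe destroys PSD**: `¬ VernierBookedPSD 1 2 0 0 (φ₀,0,0)`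
(witness `k₁ − k₃`, value `−(16/3)sin(πφ₀) < 0`); the boundary law `|φ₀| ≤ 2m` of the cell's custody-A run at
`m = 0`, kernel-grade on this direction. [cite: Zhang2022LandauSiegel, Prop 7.1 p.44, (7.2); §2 (2.13)] -/
theorem not_vernierBookedPSD_std_nearPhase {φ₀ : ℝ} (h0 : 0 < φ₀) (h1 : φ₀ < 1) :
    ¬ VernierBookedPSD 1 2 0 0 ![φ₀, 0, 0] := by
  intro h
  have hu1 : (fun y : ℝ => (1:ℂ) * afeDir 1 y + 0 * afeDir 2 y + (-1) * afeDir 3 y) 1 = 0 := by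
    simp only [afeDir_one]; norm_num
  have hv := h _ _ (kinkedProfile_afeSpan 1 0 (-1)) hu1
  rw [formDet_vernierBooked_std_nearPhase_k13] at hv
  have hs : 0 < Real.sin (π * φ₀) := by
    apply Real.sin_pos_of_pos_of_lt_pi
    · positivity
    · calc π * φ₀ < π * 1 := by exact mul_lt_mul_of_pos_left h1 Real.pi_pos
        _ = π := mul_one π
  linarith

/-- At `φ₀ = 0` (no phase) the same direction is NULL — the printed kernel direction `k₁ − k₃`
(consistent with `Det.formDet_zhang_k13`). [cite: Zhang2022LandauSiegel, Prop 7.1 p.44; (8.11)–(8.23)] -/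
theorem formDet_vernierBooked_std_nearPhase_zero_k13 :
    FormDet (vernierBooked 1 2 0 0 ![0, 0, 0])
        (fun y => (1:ℂ) * afeDir 1 y + 0 * afeDir 2 y + (-1) * afeDir 3 y)
        (fun y => (1:ℂ) * afeDir' 1 y + 0 * afeDir' 2 y + (-1) * afeDir' 3 y) = 0 := by
  rw [formDet_vernierBooked_std_nearPhase_k13]; simp

end Literature.NumberTheory.LFunctions.Zhang2022.KnifeEdgeEll.Vernier
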